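import Summits.HodgeConjecture.CorCM.Model.CMDominationOfRiemann
import HarnessLib

/-!
# COR-CM (cell `pub-hodgecm2`): every complex abelian variety of CM type is dominated by a product
# `∏_j A_{(F,Θ_j)}` over one Galois CM field `F` of degree `≥ 6` — modulo Riemann's theorem and the
# CM-realisation record `h₃` ONLY (no Picard uniformisation datum `hU`)

Companion of `CorCM/Model/CMDominationOfRiemann.lean` (seat b18: the same conclusion over `hR`, `hU`,
`h₃`). There the domination of an arbitrary CM abelian variety `A` runs through the CODED universe
`PicardCM.Var.scheme hU h₃ v` of stage 1 (`Model.hDomPos_of_riemann`, `coded_avDominatedBy`), whose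
interpretation function takes the Picard-modular-surface uniformisation datum `hU` as an argument even on
the CM-flagged codes where it is not used. This file runs the same induction directly over the tree's
`AbelianVariety.IsProductOf IsCMTyped` (finite products of CM-typed abelian varieties), so that `hU`
never enters:

* `isProductOf_isCMTyped_avDominatedBy` — for `B` a finite product of CM-typed abelian varieties there is
  a CM-flagged code `v` (recording only the leaf CM fields, as subfields of `ℂ`, and their types) such
  that for every CM field `F` receiving the leaf fields (`LeafEmbeddable F v`), `B` — and every
  `cmProdAV F h₃ m Θ' × B` — is dominated by some `cmProdAV F h₃ n Θ` (leaves: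
  `IsCMTyped.exists_isogeny_to_cmRealisation` + `avDominatedBy_inflate_code`, i.e. Shimura §6.1 Corollary
  and §6.2 Theorem 3; products: `AVDominatedBy.prod` and the associator, accumulator form as in
  `coded_avDominatedBy`);
* `cmDominated_of_isOfCMType_of_riemann` — **for every complex abelian variety `A` of CM type there are a
  Galois CM field `F` with `6 ≤ [F:ℚ]`, CM types `Θ₀, …, Θ_n` of `F` and a domination
  `AVDominatedBy A (cmProdAV F h₃ n Θ)`, modulo `hR : DeligneMilne1982_Thm_6_20_full` and
  `h₃ : CMAbelianVarietyRealised` only**: dimension `0` by `AVDominatedBy.of_dim_eq_zero` over `ℚ(ζ₇)`;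
  positive dimension by the tree's hereditary Poincaré decomposition into CM-typed factors
  (`Milne1999.hDecompPos_of_hSimplePos ∘ hSimplePos_of_riemann`, kernel modulo `hR`), the lemma above with
  `hd := thm3_isogenousPower_of_riemann hR h₃`, `hcor := thm2_cor_of_riemann hR`, and the common Galois CM
  field of the code (`commonField`, receives `ℚ(ζ₇)`, degree `≥ 6`).

Theorems only; no named fact (D-0026). Consumer: `CorCM/Milne2020OfRiemannRealised.lean` (Milne 2020
Thm. 1 / André 1992 for arbitrary CM abelian varieties modulo `hR`, `h₃` only).

References: G. Shimura, *Abelian Varieties with Complex Multiplication and Modular Functions* (1998),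
§5.1 Props. 3–6, §6.1 Corollary of Theorem 2 (p. 41), §6.2 Theorem 3 (pp. 41–43), §18.2 Lemma (ii)–(iii);
D. Mumford, *Abelian Varieties* (1970), §19 Thm. 1 (Poincaré); P. Deligne, J. S. Milne, *Tannakian
Categories*, LNM 900 (1982), Thm. 6.20 (Riemann).
-/

noncomputable section

open CategoryTheory NumberField
open Literature.AlgebraicGeometry.Motives Literature.AlgebraicGeometry.HodgeTheory
open Literature.AlgebraicGeometry.ComplexMultiplication Literature.AlgebraicGeometry.Milne1999
open Literature.NumberTheory.Automorphic
open Literature.NumberTheory.Automorphic.PicardCM (CMCode cmRealisation CMAbelianVarietyRealised)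
open Literature.NumberTheory.ComplexMultiplication (inducedCMType)

namespace Summit.HodgeConjecture.CorCM.Domination

/-- **Finite products of CM-typed abelian varieties are dominated by `∏_j A_{(F,Θ_j)}`** (with
accumulator), over every CM field `F` receiving the leaf fields of a code `v` that records the leaf CM
fields and types. Leaves: a CM-typed `A` is isogenous to the chosen realisation of the code of its type
(`IsCMTyped.exists_isogeny_to_cmRealisation`, Shimura §6.1 Corollary), which is dominated by the realisation
of the induced type over `F` (`avDominatedBy_inflate_code`, §6.2 Theorem 3); products: `AVDominatedBy.prod`,
the associator `prodAssoc`, and clause (ii) as induction hypothesis.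
[cite: Shimura1998, §6.1 Corollary of Theorem 2 (p. 41) and §6.2 Theorem 3 (pp. 41–43)] -/
theorem isProductOf_isCMTyped_avDominatedBy (h₃ : CMAbelianVarietyRealised)
    (hd : Shimura1998_Thm3_isogenousPower) (hcor : Shimura1998_Thm2_Cor) {B : AbelianVariety ℂ}
    (hB : AbelianVariety.IsProductOf IsCMTyped B) :
    ∃ v : PicardCM.Var, ∀ (F : Type) [Field F] [NumberField F] [IsCMField F], LeafEmbeddable F v →
      (∃ (n : ℕ) (Θ : Fin (n + 1) → CMType F), AVDominatedBy B (cmProdAV F h₃ n Θ)) ∧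
      (∀ (m : ℕ) (Θ' : Fin (m + 1) → CMType F),
        ∃ (n : ℕ) (Θ : Fin (n + 1) → CMType F),
          AVDominatedBy ((cmProdAV F h₃ m Θ').prod B) (cmProdAV F h₃ n Θ)) := by
  induction hB with
  | atom hA =>
      obtain ⟨c, g, hg⟩ := hA.exists_isogeny_to_cmRealisation hcor h₃
      refine ⟨.cm c, fun F _ _ _ hF => ?_⟩
      obtain ⟨k⟩ := hF
      have hleaf : AVDominatedBy _ (cmRealisation h₃ (cmCode F (inducedCMType k c.Φ))).AV :=
        AVDominatedBy.of_isIsogeny_hom hg (avDominatedBy_inflate_code hd hcor h₃ c k)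
      refine ⟨⟨0, fun _ => inducedCMType k c.Φ, hleaf⟩, fun m Θ' => ⟨m + 1, Fin.snoc Θ' (inducedCMType k c.Φ), ?_⟩⟩
      rw [cmProdAV_snoc]
      exact (AVDominatedBy.refl _).prod hleaf
  | prod _ _ ih₁ ih₂ =>
      obtain ⟨v₁, IH₁⟩ := ih₁
      obtain ⟨v₂, IH₂⟩ := ih₂
      refine ⟨.prod v₁ v₂, fun F _ _ _ hF => ?_⟩
      have I₁ := IH₁ F hF.1
      have I₂ := IH₂ F hF.2
      constructor
      · obtain ⟨n₁, Θ₁, h₁⟩ := I₁.1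
        obtain ⟨n, Θ, h⟩ := I₂.2 n₁ Θ₁
        exact ⟨n, Θ, (h₁.prod (AVDominatedBy.refl _)).trans h⟩
      · intro m Θ'
        obtain ⟨n', Θ'', h'⟩ := I₁.2 m Θ'
        obtain ⟨n, Θ, h⟩ := I₂.2 n' Θ''
        exact ⟨n, Θ, (AVDominatedBy.of_iso (prodAssoc _ _ _) (h'.prod (AVDominatedBy.refl _))).trans h⟩

/-- **Every complex abelian variety of CM type is dominated by `∏_j A_{(F,Θ_j)}` over a Galois CM field
`F` of degree `≥ 6` — modulo Riemann's theorem `hR` and the CM-realisation record `h₃` only** (no Picard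
uniformisation datum). Dimension `0`: `AVDominatedBy.of_dim_eq_zero` over `ℚ(ζ₇)`. Positive dimension:
the hereditary Poincaré decomposition of `A` into CM-typed factors up to isogeny
(`Milne1999.hDecompPos_of_hSimplePos (hSimplePos_of_riemann hR)`), `isProductOf_isCMTyped_avDominatedBy`
with the Shimura inputs `thm3_isogenousPower_of_riemann hR h₃` / `thm2_cor_of_riemann hR`, and the common
Galois CM field of the resulting code (`commonField`, `six_le_finrank_commonField`).
[cite: Shimura1998, §5.1 Props. 3–6, §6.1 Corollary of Theorem 2 (p. 41), §6.2 Theorem 3 (pp. 41–43), §18.2 Lemma (ii)–(iii)]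
[cite: MumfordAV1970, §19 Thm. 1] [cite: DeligneMilne1982Tannakian, §6 Thm. 6.20 (Riemann), print p. 212] -/
theorem cmDominated_of_isOfCMType_of_riemann (hR : DeligneMilne1982_Thm_6_20_full)
    (h₃ : CMAbelianVarietyRealised) (A : AbelianVariety ℂ) (hCM : IsOfCMType A) :
    ∃ (F : Type) (_ : Field F) (_ : NumberField F) (_ : IsCMField F),
      IsGalois ℚ F ∧ 6 ≤ Module.finrank ℚ F ∧
        ∃ (n : ℕ) (Θ : Fin (n + 1) → CMType F), AVDominatedBy A (cmProdAV F h₃ n Θ) := by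
  rcases Nat.eq_zero_or_pos A.dim with hA0 | hA0
  · haveI : IsCMField (CyclotomicField 7 ℚ) := isCMField_cyclotomic7
    let Φ : CMType (CyclotomicField 7 ℚ) := IdeleClassGroup.cmTypeOf _ (fun _ => 1) fun _ => one_ne_zero
    exact ⟨CyclotomicField 7 ℚ, inferInstance, inferInstance, isCMField_cyclotomic7, isGalois_cyclotomic7,
      finrank_cyclotomic7.ge, 0, fun _ => Φ, AVDominatedBy.of_dim_eq_zero A _ hA0⟩
  · obtain ⟨B, hB, hAB⟩ := hDecompPos_of_hSimplePos (hSimplePos_of_riemann hR) A hA0 hCM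
    obtain ⟨v, hv⟩ := isProductOf_isCMTyped_avDominatedBy h₃ (thm3_isogenousPower_of_riemann hR h₃)
      (thm2_cor_of_riemann hR) hB
    obtain ⟨n, Θ, h⟩ := (hv (commonField v) (leafEmbeddable_commonField v)).1
    exact ⟨commonField v, inferInstance, inferInstance, inferInstance, isGalois_commonField v,
      six_le_finrank_commonField v, n, Θ, AVDominatedBy.of_isIsogenous hAB h⟩

end Summit.HodgeConjecture.CorCM.Domination

end
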